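import Summits.NavierStokesRegularity.FluidComputer.GateBudgetDudLattice
import Summits.NavierStokesRegularity.FluidComputer.GateBudgetDynamicLevels
import HarnessLib

/-!
# What no tuning can beat, part 20: THE LATTICE MEMBER IS A DUD, FROM THE DYNAMICS — every
# dyadic knob window with `σ_knob M ≤ 2` contains a member whose output is capped until after
# its clock has died (S13″c assembled)

Cell `pub-fluidc`, blueprint seat bp1 (gen 29, third item); same namespace and conventions as
parts 1–19 (`GateBudget*.lean`); imports part 17 (`GateBudgetDudLattice`: the output cap
`knob_lattice_dud` on the lattice `ε = kMρ²` GIVEN fourteen level hypotheses at two times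
`s₀ ≤ T`, and the lattice member `exists_lattice_knob` of every dyadic window) and part 19
(`GateBudgetDynamicLevels`: exactly those levels, read off ONE exact trajectory with typed hitting
times, under the polynomial trigger hypotheses and one largeness hypothesis on the amplifier).
Modes `0 = a` input, `1 = b` clock, `2 = c` catalyst (`u = c/ρ²`), `3 = d` transfer, `4 = ã`
output; `σ_knob = ρ²/ε`. HONEST FRAMING (verbatim): low prior, high value-of-information
experiment on Tao's machine paradigm; NOT a claim that NS blows up.

THE POINT. The two halves are composed. §57 is the arithmetic of the lattice: with `kρ² = ε/M`
and `arctan x ≤ x` the phase budget of part 17 is below the CLOSED FORM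
`6/(MK¹⁰) + 16e^{-M}/M² + (κ·(100π/(49M)) + 10e^{-M}Δ/(7M))/(1 - 100/(49M)) + 3/(2K¹⁰)` for any
`κ ≥ k` — the critical winding `k·πq/(1 - q)`, `q = 100/(49M)`, is its only term that is not
`O(K⁻¹⁰ + e^{-M})` — and the drift is below `6(ε + Pe^{-M} + 3/K⁹) + 2(ε + Pe^{-M} + 3/K⁹ + K²Δ)Δ`
for any `P ≥ ρ²`, where `Δ ≥ (8/M)log(25εK¹⁰/(8ρ²)) + 200/(169M - 400)` bounds the length of
the pulse window; the afterglow constant is `16(K⁻¹⁰ + 4e^{-M}/M + ε)/M + 4e^{-M}/M`. §58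
(`knob_lattice_member_dud`): on the lattice, under the polynomial trigger hypotheses
(`16 ≤ K`, `48 log K ≤ M ≤ K¹⁰`, `ε² ≤ 1/(6K²⁰)`; `ρ² ≤ ε` and `Mρ⁴ ≤ ε²` now FOLLOW from
`ε = kMρ²`, `k ≥ 1`) and `Δ < 1/16`, the output obeys
`ã(t)² ≤ 1 - (1 - ψ²/2 - D)² + 16(K⁻¹⁰ + 4e^{-M}/M + ε)/M + 4e^{-M}/M` on `[0, T + 1/8]`, where
`1 ≤ s₀ ≤ 3/2 < T ≤ s₀ + Δ` are the member's OWN critical and dousing times and `ψ`, `D` are any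
numbers above the two closed forms with `ψ²/2 + D ≤ 1`. §59 (`knob_window_member_dud`): for a
FAMILY of exact trajectories `X r` of `rotorCircuit K M ε r` from (5.6), one for every knob value
`r`, and every window `[ρhi²/2, ρhi²]` with `Mρhi² ≤ 2ε`, the member `r² = ε/(kM)` of part 17's
`exists_lattice_knob` satisfies §58 with `κ = 2ε/(Mρhi²)`, `P = ρhi²` and `4ρhi²` in place of
`8ρ²` inside the logarithm: EVERY SUCH WINDOW CONTAINS A MEMBER WHOSE OUTPUT IS CAPPED UNTIL
AFTER ITS CLOCK HAS DIED — the machine's firing is not robust in the knob at scale `σ_knob M ~ 1`,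
now as a theorem about the differential equation alone (parts 12–19 supplied every level).

HONEST LIMITS. (i) The cap is informative only when `ψ²/2 + D` is small: `ψ ≈ 6.41κ/M` wants
`κ = 2ε/(Mρhi²) ≲ M/10`, i.e. windows with `σ_knob·M ≥ 20/M` (`σ_knob = ρhi²/ε`), and `D`
contains `2K²Δ²` with `Δ ≈ (8/M)log(25εK¹⁰/(4ρhi²))`, so a SECOND largeness
`M ≳ 2⁴K·log(25εK¹⁰/(4ρhi²))` is needed — both stay the explicit hypotheses `hψ`, `hD`, `hm` and
are NOT discharged here (at the headline amplifier `M = K¹⁰` they hold for every window with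
`20ε/K²⁰ ≤ ρhi²`, `Mρhi² ≤ 2ε`; that routine check is not performed in this file). (ii) One
member per window, on `[0, T + 1/8]` with ITS OWN `T` (`1 < T < 25/16`); a second pulse after
`T + 1/8` is not excluded (part 10's no-return needs the armed radius re-bought). (iii) Nothing
is claimed about the other members, about firing, or about Navier–Stokes.
[cite: Tao2016AveragedNS, §5.5 Theorem 5.3, (5.5), (5.6), (b-eq), (c-eq), (tcable)]
-/

noncomputable section

namespace Summit.NavierStokesRegularity.FluidComputer.GateBudget

open Real Set Filter Topology
open Literature.Analysis.FluidPDE.Tao2016AveragedNS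

variable {K M ε ρ : ℝ} {X : ℝ → Fin 5 → ℝ} {C : ℝ → ℝ}

/-! ## §57 The arithmetic of the lattice: closed forms for the phase budget and the drift -/

/-- **The phase budget on the lattice, closed form.** With `ε = kMρ²` (so `kρ² = ε/M`), `k ≤ κ`,
`M ≥ 133` and `T - s₀ = τ ≤ Δ`, part 17's phase budget at the levels of part 19 (`b₁ = ε/2`,
`γ₁ = ρ²/K¹⁰`, `β = ε/4`, `λ₀ = K⁻¹⁰ + 4e^{-M}/M`, `ϱ = 7ε/10`, `φ₀ = 3/(2K¹⁰)`; critical ratio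
`q = ε²/(Mϱ²) = 100/(49M)`) is at most
`6/(MK¹⁰) + 16e^{-M}/M² + (κ·π·100/(49M) + 10e^{-M}Δ/(7M))/(1 - 100/(49M)) + 3/(2K¹⁰)`
(`arctan x ≤ x`; the `k` of the drift term cancels against `ρ²/ε = 1/(kM)`).
[cite: Tao2016AveragedNS, §5.5 Theorem 5.3, (b-eq), (c-eq)] -/
theorem lattice_psi_le {K M ε ρ τ Δ κ : ℝ} (k : ℕ) (hk : ε = k * M * ρ ^ 2) (hκ : (k : ℝ) ≤ κ)
    (hε : 0 < ε) (hρ : 0 < ρ) (hM : 133 ≤ M) (hK : 0 < K) (hτ : τ ≤ Δ) :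
    k * (arctan (ρ ^ 2 / K ^ 10 / (ε / 2))
        + arctan ((1 / K ^ 10 + 4 * exp (-M) / M) * ρ ^ 2 / (ε / 4))
        + (π * (ε ^ 2 / (M * (7 / 10 * ε) ^ 2)) + ρ ^ 2 * exp (-M) * τ / (7 / 10 * ε))
          / (1 - ε ^ 2 / (M * (7 / 10 * ε) ^ 2))) + 3 / (2 * K ^ 10)
      ≤ 6 / (M * K ^ 10) + 16 * exp (-M) / M ^ 2
        + (κ * (π * (100 / (49 * M))) + 10 * exp (-M) * Δ / (7 * M)) / (1 - 100 / (49 * M))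
        + 3 / (2 * K ^ 10) := by
  -- `arctan x ≤ x` for `x ≥ 0` (from `x ≤ tan x` on `[0, π/2)`), as a local fact
  have harc : ∀ {x : ℝ}, 0 ≤ x → arctan x ≤ x := fun {x} hx => by
    have h := Real.le_tan (Real.arctan_nonneg.2 hx) (Real.arctan_lt_pi_div_two x)
    rwa [Real.tan_arctan] at h
  have hM0 : 0 < M := by linarith
  have hk0 : (0 : ℝ) ≤ k := Nat.cast_nonneg k
  have hK10 : 0 < K ^ 10 := by positivity
  have heM : 0 < exp (-M) := exp_pos _
  -- the lattice identity `kρ² = ε/M` and the critical ratio `q = 100/(49M) < 1`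
  have hkρ : (k : ℝ) * ρ ^ 2 = ε / M := by
    rw [eq_div_iff hM0.ne']; rw [hk]; ring
  have hq : ε ^ 2 / (M * (7 / 10 * ε) ^ 2) = 100 / (49 * M) := by
    field_simp; ring
  rw [hq]
  have hq1 : 0 < 1 - 100 / (49 * M) := by
    rw [sub_pos, div_lt_one (by positivity)]; linarith
  -- the two arctangents
  have h1 : (k : ℝ) * arctan (ρ ^ 2 / K ^ 10 / (ε / 2)) ≤ 2 / (M * K ^ 10) := by
    have hx : 0 ≤ ρ ^ 2 / K ^ 10 / (ε / 2) := by positivity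
    calc (k : ℝ) * arctan (ρ ^ 2 / K ^ 10 / (ε / 2))
        ≤ k * (ρ ^ 2 / K ^ 10 / (ε / 2)) :=
          mul_le_mul_of_nonneg_left (harc hx) hk0
      _ = 2 * (k * ρ ^ 2) / (ε * K ^ 10) := by field_simp
      _ = 2 / (M * K ^ 10) := by rw [hkρ]; field_simp
  have h2 : (k : ℝ) * arctan ((1 / K ^ 10 + 4 * exp (-M) / M) * ρ ^ 2 / (ε / 4))
      ≤ 4 / (M * K ^ 10) + 16 * exp (-M) / M ^ 2 := by
    have hx : 0 ≤ (1 / K ^ 10 + 4 * exp (-M) / M) * ρ ^ 2 / (ε / 4) := by positivity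
    calc (k : ℝ) * arctan ((1 / K ^ 10 + 4 * exp (-M) / M) * ρ ^ 2 / (ε / 4))
        ≤ k * ((1 / K ^ 10 + 4 * exp (-M) / M) * ρ ^ 2 / (ε / 4)) :=
          mul_le_mul_of_nonneg_left (harc hx) hk0
      _ = 4 * (1 / K ^ 10 + 4 * exp (-M) / M) * (k * ρ ^ 2) / ε := by field_simp
      _ = 4 / (M * K ^ 10) + 16 * exp (-M) / M ^ 2 := by rw [hkρ]; field_simp; ring
  -- the drift term of the phase budget: `k` cancels
  have h3 : (k : ℝ) * (ρ ^ 2 * exp (-M) * τ / (7 / 10 * ε)) ≤ 10 * exp (-M) * Δ / (7 * M) := by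
    calc (k : ℝ) * (ρ ^ 2 * exp (-M) * τ / (7 / 10 * ε))
        = 10 * exp (-M) * τ * (k * ρ ^ 2) / (7 * ε) := by field_simp
      _ = 10 * exp (-M) * τ / (7 * M) := by rw [hkρ]; field_simp
      _ ≤ 10 * exp (-M) * Δ / (7 * M) := by
          apply div_le_div_of_nonneg_right _ (by positivity)
          exact mul_le_mul_of_nonneg_left hτ (by positivity)
  -- the critical winding, `k ≤ κ`
  have h4 : (k : ℝ) * (π * (100 / (49 * M))) ≤ κ * (π * (100 / (49 * M))) :=
    mul_le_mul_of_nonneg_right hκ (by positivity)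
  have hsplit : (k : ℝ) * (arctan (ρ ^ 2 / K ^ 10 / (ε / 2))
        + arctan ((1 / K ^ 10 + 4 * exp (-M) / M) * ρ ^ 2 / (ε / 4))
        + (π * (100 / (49 * M)) + ρ ^ 2 * exp (-M) * τ / (7 / 10 * ε))
          / (1 - 100 / (49 * M)))
      = k * arctan (ρ ^ 2 / K ^ 10 / (ε / 2))
        + k * arctan ((1 / K ^ 10 + 4 * exp (-M) / M) * ρ ^ 2 / (ε / 4))
        + (k * (π * (100 / (49 * M))) + k * (ρ ^ 2 * exp (-M) * τ / (7 / 10 * ε)))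
          / (1 - 100 / (49 * M)) := by ring
  rw [hsplit]
  have h5 : ((k : ℝ) * (π * (100 / (49 * M))) + k * (ρ ^ 2 * exp (-M) * τ / (7 / 10 * ε)))
        / (1 - 100 / (49 * M))
      ≤ (κ * (π * (100 / (49 * M))) + 10 * exp (-M) * Δ / (7 * M)) / (1 - 100 / (49 * M)) :=
    div_le_div_of_nonneg_right (by linarith) hq1.le
  have h6 : (6 : ℝ) / (M * K ^ 10) = 2 / (M * K ^ 10) + 4 / (M * K ^ 10) := by ring
  linarith [h6]

/-- **The drift on the lattice, closed form.** With `K ≥ 1`, `ρ² ≤ P`, `0 ≤ s₀ ≤ 3/2`,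
`0 ≤ T - s₀ ≤ Δ` and part 19's output levels `ã(s₀) ≤ 3/K¹⁰`, `ã(T) ≤ ã(s₀) + K(T - s₀)`, part
17's drift `4L_{s₀}s₀ + 2L_T(T - s₀)` (`L_t = ε + ρ²e^{-M} + K·ã(t)`) is at most
`6(ε + Pe^{-M} + 3/K⁹) + 2(ε + Pe^{-M} + 3/K⁹ + K²Δ)Δ`.
[cite: Tao2016AveragedNS, §5.5 Theorem 5.3, (tcable)] -/
theorem lattice_drift_le {K M ε ρ P s₀ T Δ a₀ aT : ℝ} (hK : 1 ≤ K) (hε : 0 ≤ ε)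
    (hP : ρ ^ 2 ≤ P) (hs0 : 0 ≤ s₀) (hs : s₀ ≤ 3 / 2) (hT0 : 0 ≤ T - s₀) (hT : T - s₀ ≤ Δ)
    (ha₀ : a₀ ≤ 3 / K ^ 10) (haT : aT ≤ a₀ + K * (T - s₀)) :
    4 * ((ε + ρ ^ 2 * exp (-M) + K * a₀) * s₀)
        + 2 * ((ε + ρ ^ 2 * exp (-M) + K * aT) * (T - s₀))
      ≤ 6 * (ε + P * exp (-M) + 3 / K ^ 9)
        + 2 * (ε + P * exp (-M) + 3 / K ^ 9 + K ^ 2 * Δ) * Δ := by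
  have hK0 : 0 ≤ K := by linarith
  have hK9 : 0 < K ^ 9 := by positivity
  have heM : 0 ≤ exp (-M) := (exp_pos _).le
  have hPe : ρ ^ 2 * exp (-M) ≤ P * exp (-M) := mul_le_mul_of_nonneg_right hP heM
  have hP0 : 0 ≤ P * exp (-M) := le_trans (by positivity) hPe
  have hΔ0 : 0 ≤ Δ := le_trans hT0 hT
  have hKa₀ : K * a₀ ≤ 3 / K ^ 9 := by
    calc K * a₀ ≤ K * (3 / K ^ 10) := mul_le_mul_of_nonneg_left ha₀ hK0
      _ = 3 / K ^ 9 := by field_simp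
  have hKaT : K * aT ≤ 3 / K ^ 9 + K ^ 2 * Δ := by
    calc K * aT ≤ K * (a₀ + K * (T - s₀)) := mul_le_mul_of_nonneg_left haT hK0
      _ = K * a₀ + K ^ 2 * (T - s₀) := by ring
      _ ≤ 3 / K ^ 9 + K ^ 2 * Δ := by
          have := mul_le_mul_of_nonneg_left hT (by positivity : (0 : ℝ) ≤ K ^ 2)
          linarith
  have hL₀ : ε + ρ ^ 2 * exp (-M) + K * a₀ ≤ ε + P * exp (-M) + 3 / K ^ 9 := by linarith
  have hL₁ : ε + ρ ^ 2 * exp (-M) + K * aT ≤ ε + P * exp (-M) + 3 / K ^ 9 + K ^ 2 * Δ := by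
    linarith
  have hE₀ : 0 ≤ ε + P * exp (-M) + 3 / K ^ 9 := by positivity
  have hE₁ : 0 ≤ ε + P * exp (-M) + 3 / K ^ 9 + K ^ 2 * Δ := by positivity
  have i₀ : (ε + ρ ^ 2 * exp (-M) + K * a₀) * s₀ ≤ (ε + P * exp (-M) + 3 / K ^ 9) * (3 / 2) :=
    le_trans (mul_le_mul_of_nonneg_right hL₀ hs0) (mul_le_mul_of_nonneg_left hs hE₀)
  have i₁ : (ε + ρ ^ 2 * exp (-M) + K * aT) * (T - s₀)
      ≤ (ε + P * exp (-M) + 3 / K ^ 9 + K ^ 2 * Δ) * Δ :=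
    le_trans (mul_le_mul_of_nonneg_right hL₁ hT0) (mul_le_mul_of_nonneg_left hT hE₁)
  linarith

/-- **The afterglow constant on the lattice.** Part 17's `A = 4ε(λ₀ + ε)/(Mβ) + 4e^{-M}/M` at
`β = ε/4`, `λ₀ = K⁻¹⁰ + 4e^{-M}/M` is `16(K⁻¹⁰ + 4e^{-M}/M + ε)/M + 4e^{-M}/M`.
[cite: Tao2016AveragedNS, §5.5 Theorem 5.3, (tcable)] -/
theorem lattice_afterglow_eq {K M ε : ℝ} (hε : 0 < ε) (hM : 0 < M) :
    4 * ε * ((1 / K ^ 10 + 4 * exp (-M) / M) + ε) / (M * (ε / 4)) + 4 * exp (-M) / M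
      = 16 * (1 / K ^ 10 + 4 * exp (-M) / M + ε) / M + 4 * exp (-M) / M := by
  congr 1
  field_simp
  ring

/-! ## §58 The lattice member is a dud: part 19 feeds part 17 -/

/-- **THE LATTICE MEMBER IS A DUD — from the dynamics (S13″c assembled, one member).** Along an
exact trajectory of `rotorCircuit K M ε ρ` from (5.6) ON THE LATTICE `ε = kMρ²` (`k ≥ 1`, so
the critical phase of the catalyst carrier is `kπ` and `ρ² ≤ ε`, `Mρ⁴ ≤ ε²` hold), under the
polynomial trigger hypotheses `16 ≤ K`, `48 log K ≤ M ≤ K¹⁰`, `ε² ≤ 1/(6K²⁰)` and with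
`(8/M)log(25εK¹⁰/(8ρ²)) + 200/(169M - 400) ≤ Δ < 1/16`: there are times `1 ≤ s₀ ≤ 3/2 < T`,
`T - s₀ ≤ Δ` (the member's critical time and dousing time, part 19) such that for all
`0 ≤ t ≤ T + 1/8` the output obeys
`ã(t)² ≤ 1 - (1 - ψ²/2 - D)² + 16(K⁻¹⁰ + 4e^{-M}/M + ε)/M + 4e^{-M}/M`
for ANY `ψ ≥ 6/(MK¹⁰) + 16e^{-M}/M² + (κ·π·100/(49M) + 10e^{-M}Δ/(7M))/(1 - 100/(49M)) + 3/(2K¹⁰)`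
(`κ ≥ k`) and `D ≥ 6(ε + Pe^{-M} + 3/K⁹) + 2(ε + Pe^{-M} + 3/K⁹ + K²Δ)Δ` (`P ≥ ρ²`) with
`ψ²/2 + D ≤ 1` — part 17's `knob_lattice_dud` with every level hypothesis discharged by part 19's
`knob_dynamic_levels` and the closed forms of §57. Informative when `ψ²/2 + D` is small, i.e.
`κ ≲ M/10` and `K²Δ² ≲ 1` (HONEST LIMITS (i)); nothing about NS.
[cite: Tao2016AveragedNS, §5.5 Theorem 5.3, (5.5), (5.6), (b-eq), (c-eq), (tcable)] -/
theorem knob_lattice_member_dud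
    (hX : ∀ t, HasDerivAt X (RotorKnob.rotorCircuit K M ε ρ (X t)) t)
    (h0 : X 0 = delayInit) (hε : 0 < ε) (hρ : 0 < ρ) (hM : 0 < M) (hMK : M ≤ K ^ 10)
    (hK : 16 ≤ K) (hML : 48 * Real.log K ≤ M) (hεK : ε ^ 2 ≤ 1 / (6 * K ^ 20))
    (hC : ∀ t, HasDerivAt C (X t 2) t) (k : ℕ) (hk1 : 1 ≤ k) (hk : ε = k * M * ρ ^ 2)
    {κ P Δ ψ D : ℝ} (hκ : (k : ℝ) ≤ κ) (hP : ρ ^ 2 ≤ P)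
    (hΔ : 8 * log (25 * ε * K ^ 10 / (8 * ρ ^ 2)) / M + 200 / (169 * M - 400) ≤ Δ)
    (hH : Δ < 1 / 16)
    (hψ : 6 / (M * K ^ 10) + 16 * exp (-M) / M ^ 2
        + (κ * (π * (100 / (49 * M))) + 10 * exp (-M) * Δ / (7 * M)) / (1 - 100 / (49 * M))
        + 3 / (2 * K ^ 10) ≤ ψ)
    (hD : 6 * (ε + P * exp (-M) + 3 / K ^ 9)
        + 2 * (ε + P * exp (-M) + 3 / K ^ 9 + K ^ 2 * Δ) * Δ ≤ D)
    (hm : 0 ≤ 1 - ψ ^ 2 / 2 - D) :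
    ∃ s₀ T : ℝ, 1 ≤ s₀ ∧ s₀ ≤ 3 / 2 ∧ s₀ < T ∧ T - s₀ ≤ Δ ∧
      ∀ t ∈ Icc 0 (T + 1 / 8), X t 4 ^ 2
        ≤ 1 - (1 - ψ ^ 2 / 2 - D) ^ 2
          + (16 * (1 / K ^ 10 + 4 * exp (-M) / M + ε) / M + 4 * exp (-M) / M) := by
  have hK0 : 0 < K := by linarith
  have hK1 : 1 ≤ K := by linarith
  have hk0 : (1 : ℝ) ≤ k := by exact_mod_cast hk1
  have hε2 : 0 < ε ^ 2 := by positivity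
  have hM133 : 133 ≤ M := by
    have h16 : log 16 = 4 * log 2 := by
      rw [show (16 : ℝ) = 2 ^ 4 by norm_num, Real.log_pow]; norm_num
    have hlogK : log 16 ≤ log K := log_le_log (by norm_num) hK
    linarith [Real.log_two_gt_d9]
  -- consequences of the lattice relation `ε = kMρ²`, `kM ≥ 1`
  have hkM : 1 ≤ (k : ℝ) * M := by nlinarith
  have hρε : ρ ^ 2 ≤ ε := by
    have h := mul_le_mul_of_nonneg_right hkM (sq_nonneg ρ)
    rw [one_mul] at h
    rw [hk]; exact h
  have hMρ : M * ρ ^ 4 ≤ ε ^ 2 := by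
    have h1 : (k : ℝ) * M ≤ k * M * (k * M) := le_mul_of_one_le_right (by positivity) hkM
    have h2 : M ≤ (k : ℝ) * M := le_mul_of_one_le_left hM.le hk0
    have h3 := mul_le_mul_of_nonneg_right (h2.trans h1) (by positivity : (0 : ℝ) ≤ ρ ^ 4)
    calc M * ρ ^ 4 ≤ k * M * (k * M) * ρ ^ 4 := h3
      _ = ε ^ 2 := by rw [hk]; ring
  have hε1 : ε ≤ 1 := by
    have hK20 : (1700 : ℝ) ≤ K ^ 20 :=
      le_trans (by norm_num) (pow_le_pow_left₀ (by norm_num) hK 20)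
    have h1 : ε ^ 2 ≤ 1 := by
      refine hεK.trans ?_
      rw [div_le_one (by positivity)]; linarith
    nlinarith
  -- §56: the levels at the member's critical time `s₀` and dousing time `T`
  obtain ⟨s₀, T, hs1, hs32, hsT, hTΔ, hcpos, harm, hbs, hcs, hbT, hcT, hΦ, ha₀, haT, -, -⟩ :=
    knob_dynamic_levels hX h0 hε hρ hρε hM hMK hK hML hεK hMρ hC (lt_of_le_of_lt hΔ hH)
  have hTΔ' : T - s₀ ≤ Δ := hTΔ.trans hΔ
  refine ⟨s₀, T, hs1, hs32, hsT, hTΔ', fun t ht => ?_⟩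
  have hs0 : 0 ≤ s₀ := by linarith
  -- the critical ratio is subunit on the window radius `ϱ = 7ε/10`: `q = 100/(49M) < 1`
  have hq : ε ^ 2 < M * (7 / 10 * ε) ^ 2 := by
    have hMε : 133 * ε ^ 2 ≤ M * ε ^ 2 := mul_le_mul_of_nonneg_right hM133 hε2.le
    have h49 : M * (7 / 10 * ε) ^ 2 = 49 / 100 * (M * ε ^ 2) := by ring
    rw [h49]; linarith
  -- the horizon `T + β/(2ε) = T + 1/8`
  have hth : t ∈ Icc 0 (T + ε / 4 / (2 * ε)) := by
    have h8 : ε / 4 / (2 * ε) = 1 / 8 := by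
      field_simp; ring
    rw [h8]; exact ht
  -- §53 applied with the levels of §56 and the closed forms of §57
  have key := knob_lattice_dud hX h0 hε hε1 hρ hρε hM hK0.le hC k hk
    (ϱ := 7 / 10 * ε) (β := ε / 4) (b₁ := ε / 2) (γ₁ := ρ ^ 2 / K ^ 10)
    (lam₀ := 1 / K ^ 10 + 4 * exp (-M) / M) (φ₀ := 3 / (2 * K ^ 10)) (ψ := ψ) (D := D)
    hs0 hsT.le (by positivity) hq hcpos harm (by positivity) hbs hcs.le (by positivity) hbT hcT
    hΦ ((lattice_psi_le k hk hκ hε hρ hM133 hK0 hTΔ').trans hψ)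
    ((lattice_drift_le hK1 hε.le hP hs0 hs32 (by linarith) hTΔ' ha₀ haT).trans hD) hm hth
  have hA := lattice_afterglow_eq (K := K) hε hM
  linarith [key, hA]

/-! ## §59 Every dyadic knob window contains a dud -/

/-- **EVERY DYADIC KNOB WINDOW WITH `σ_knob M ≤ 2` CONTAINS A DUD — from the dynamics.** Let
`X r` be, for every knob value `r`, an exact trajectory of `rotorCircuit K M ε r` from (5.6)
and `C r` a primitive of its catalyst; assume the polynomial trigger hypotheses `16 ≤ K`,
`48 log K ≤ M ≤ K¹⁰`, `ε² ≤ 1/(6K²⁰)`. For every window `[ρhi²/2, ρhi²]` with `Mρhi² ≤ 2ε` and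
`(8/M)log(25εK¹⁰/(4ρhi²)) + 200/(169M - 400) ≤ Δ < 1/16` there is a member `r`,
`ρhi²/2 ≤ r² ≤ ρhi²` (the lattice point `r² = ε/(kM)` of part 17's `exists_lattice_knob`), with
its own times `1 ≤ s₀ ≤ 3/2 < T ≤ s₀ + Δ`, whose output obeys
`ã(t)² ≤ 1 - (1 - ψ²/2 - D)² + 16(K⁻¹⁰ + 4e^{-M}/M + ε)/M + 4e^{-M}/M` on `[0, T + 1/8]` for
any `ψ ≥ 6/(MK¹⁰) + 16e^{-M}/M² + ((2ε/(Mρhi²))·π·100/(49M) + 10e^{-M}Δ/(7M))/(1 - 100/(49M))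
+ 3/(2K¹⁰)`, `D ≥ 6(ε + ρhi²e^{-M} + 3/K⁹) + 2(ε + ρhi²e^{-M} + 3/K⁹ + K²Δ)Δ` with
`ψ²/2 + D ≤ 1`: §58 at the lattice member, `κ = 2ε/(Mρhi²) ≥ k`, `P = ρhi² ≥ r²`,
`8r² ≥ 4ρhi²` inside the logarithm. The S13″c non-robustness of the firing in the knob at scale
`σ_knob M ~ 1`, as a theorem about the ODE alone; informative under HONEST LIMITS (i)–(iii).
[cite: Tao2016AveragedNS, §5.5 Theorem 5.3, (5.5), (5.6), (b-eq), (c-eq), (tcable)] -/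
theorem knob_window_member_dud {X : ℝ → ℝ → Fin 5 → ℝ} {C : ℝ → ℝ → ℝ}
    (hX : ∀ r t, HasDerivAt (X r) (RotorKnob.rotorCircuit K M ε r (X r t)) t)
    (h0 : ∀ r, X r 0 = delayInit) (hC : ∀ r t, HasDerivAt (C r) (X r t 2) t)
    (hε : 0 < ε) (hM : 0 < M) (hMK : M ≤ K ^ 10) (hK : 16 ≤ K) (hML : 48 * Real.log K ≤ M)
    (hεK : ε ^ 2 ≤ 1 / (6 * K ^ 20)) {ρhi Δ ψ D : ℝ} (hρhi : 0 < ρhi)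
    (hwin : M * ρhi ^ 2 ≤ 2 * ε)
    (hΔ : 8 * log (25 * ε * K ^ 10 / (4 * ρhi ^ 2)) / M + 200 / (169 * M - 400) ≤ Δ)
    (hH : Δ < 1 / 16)
    (hψ : 6 / (M * K ^ 10) + 16 * exp (-M) / M ^ 2
        + (2 * ε / (M * ρhi ^ 2) * (π * (100 / (49 * M))) + 10 * exp (-M) * Δ / (7 * M))
          / (1 - 100 / (49 * M)) + 3 / (2 * K ^ 10) ≤ ψ)
    (hD : 6 * (ε + ρhi ^ 2 * exp (-M) + 3 / K ^ 9)
        + 2 * (ε + ρhi ^ 2 * exp (-M) + 3 / K ^ 9 + K ^ 2 * Δ) * Δ ≤ D)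
    (hm : 0 ≤ 1 - ψ ^ 2 / 2 - D) :
    ∃ r : ℝ, 0 < r ∧ ρhi ^ 2 / 2 ≤ r ^ 2 ∧ r ^ 2 ≤ ρhi ^ 2 ∧
      ∃ s₀ T : ℝ, 1 ≤ s₀ ∧ s₀ ≤ 3 / 2 ∧ s₀ < T ∧ T - s₀ ≤ Δ ∧
        ∀ t ∈ Icc 0 (T + 1 / 8), X r t 4 ^ 2
          ≤ 1 - (1 - ψ ^ 2 / 2 - D) ^ 2
            + (16 * (1 / K ^ 10 + 4 * exp (-M) / M + ε) / M + 4 * exp (-M) / M) := by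
  have hK0 : 0 < K := by linarith
  obtain ⟨k, hk1, hkκ, hlo, hhi⟩ := exists_lattice_knob hε hM hρhi hwin
  have hk0 : (0 : ℝ) < k := by exact_mod_cast hk1
  have hkM : (0 : ℝ) < k * M := mul_pos hk0 hM
  have hkM' : (k : ℝ) * M ≠ 0 := hkM.ne'
  -- the lattice member `r² = ε/(kM)` of the window
  obtain ⟨r, hr0, hr2⟩ : ∃ r : ℝ, 0 < r ∧ r ^ 2 = ε / (k * M) :=
    ⟨Real.sqrt (ε / (k * M)), Real.sqrt_pos.2 (by positivity), Real.sq_sqrt (by positivity)⟩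
  have hk : ε = k * M * r ^ 2 := by
    rw [hr2]; field_simp
  refine ⟨r, hr0, by rw [hr2]; exact hlo, by rw [hr2]; exact hhi, ?_⟩
  -- the member's pulse window is shorter than the window's bound: `8r² ≥ 4ρhi²`
  have hΔr : 8 * log (25 * ε * K ^ 10 / (8 * r ^ 2)) / M + 200 / (169 * M - 400) ≤ Δ := by
    refine le_trans ?_ hΔ
    have hlog : log (25 * ε * K ^ 10 / (8 * r ^ 2)) ≤ log (25 * ε * K ^ 10 / (4 * ρhi ^ 2)) := by
      apply Real.log_le_log (by positivity)
      apply div_le_div_of_nonneg_left (by positivity) (by positivity)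
      rw [hr2]; linarith [hlo]
    have h8 := mul_le_mul_of_nonneg_left hlog (by norm_num : (0 : ℝ) ≤ 8)
    have := div_le_div_of_nonneg_right h8 hM.le
    linarith
  exact knob_lattice_member_dud (hX r) (h0 r) hε hr0 hM hMK hK hML hεK (hC r) k hk1 hk hkκ
    (by rw [hr2]; exact hhi) hΔr hH hψ hD hm

end Summit.NavierStokesRegularity.FluidComputer.GateBudget
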